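import Summits.QuantumFields.BalabanUV.T4Continuum.Spine.NE1p.DressedSmallFieldRodRateWitnessLive

/-!
# T⁴ programme, spine estimate NE1′ (node O3b/H2) — WITNESS «THE μ-PART TWIN AT RATE ONE»: the OWNER's μ-face
# `DressedSmallFieldGeometry.muPart_locE_le_geom` (N0o) FIRED IN THE INTERIOR OF ITS RATE BOOKKEEPING — `r₁ = 1`, `b = 5·r₁`,
# `R = r₁ + 2κ₀ + 2`, source window `(μ₀, μ₁) = (μ₀, 2)` — ON W72's TWO-DOMINO ROD DATUM; the μ-part of the cluster term is LIVE on the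
# whole closed unit source disc and VANISHES ONLY AT ITS CENTRE

Cell `pub-balaban`, sub-cell `t4`, row NE1′ formalisation crew (`t4/formal/NE1p/LEAVES.md` row W⟨next⟩ — own-initiative WITNESS follower
under typer R-T61 (ii) ∕ R-T140 rule (b); INTENT `HOME/CLAIMS.log` l.23234; the typer's row id ∕ DAG node are recorded at booking), unit
`b2b-balaban-t4-ne1p-formalise-leaf-09` (gen 14).  ADDITIVE — imports W72 PART 2 `Spine/NE1p/DressedSmallFieldRodRateWitnessLive` (this
lineage, gen 13, p240137; → W72 PART 1 p239676 → W67 PART 1 → … → W24 → S24 ∕ N0o → pv22) ONLY; THEOREMS ONLY — 0 `def`, 0 `def … : Prop`,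
0 cite, 0 sorry, 0 `attribute`; nothing of N0o ∕ W24 ∕ W67 ∕ W72 ∕ pv22 is restated — N0o's `muPart_locE_le_geom`∕`norm_locE_le_geom`∕`torus_consts`,
`K₀_four`, W72's `actAB`∕`envAB`∕`Aone`∕`cAB`∕`Rone`∕`hsmall_AB`∕`hhol_AB`∕`hm_AB`∕`hL3_AB`∕`two_cAB_eq`∕`Rone_eq`∕`Rone_pos`∕`Aone_pos`∕`cAB_pos`∕
`cAB_lt_half`∕`DA_ne_DB`∕`footprints`∕`ttouch_DA_DB`∕`actAB_of_ne`∕`actAB_DA`∕`actAB_DB`∕`exp_locE_of_support_pair`∕`exp_locE_rod_zero`∕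
`rodRateOne_fires_closed`, W67's `CR`∕`torusTreeLen_CR`, W33's `Acst`, pv22's `tsys_dj` are used BY NAME.

WHY.  N0o wires TWO pencil faces over a proved polymer geometry: the ATTACHED (table-strength) face `attachedPart_locE_le_geom` and the
μ-PART (source-pencil) face `muPart_locE_le_geom`.  W72 (this lineage, gen 13) fired the ATTACHED face in the interior of its rate
bookkeeping on W67's rod `C_R` (torus tree length exactly `1`); the μ-face's appliers in `Spine/NE1p` are W24's `muPart_fires_torus`
(`r₁ = b = 0`, ONE cube, tree length `0`) and the owner's kernel re-lettering N0p `muPart_locE_le_of_expLinear` (no datum) — none at a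
positive rate.  THIS FILE fires the μ-face on the SAME W72 datum with the SAME rate bookkeeping — BOTH of N0o's faces off the boundary `r₁ = 0`:
* §1 **`rodRateOneMu_fires`** — N0o's `muPart_locE_le_geom` EXACTLY ONCE BY NAME at `(tsys 4 (L·N′), tgeometry 4 (L·N′))` with
  `(A, r₁, b, R, μ₁, X₀, act, m) := (0 + 2·A₁, 1, 5, R₁, 2, C_R, actAB c, envAB (2c))` — EVERY socket a W72 PART 1 lemma BY NAME
  (`hsmall_AB`, `hhol_AB`, `hm_AB`, `hL3_AB` with `two_cAB_eq`, `Rone_eq`); the window `0 < μ₀ < 2` and `‖μ‖ ≤ μ₀` displayed; conclusion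
  LITERAL in N0o's μ-currency `e·ν·c₁·K₀²·A·e^{−(1·d(C_R))}·μ₀∕(2 − μ₀)`; **`rodRateOneMu_fires_closed` (`5 ≤ L`): `≤ K₀(64,8)·e^{−6}·μ₀∕(2 − μ₀)`**
  and at `μ₀ = 1` **`rodRateOneMu_fires_unit`: `≤ K₀(64,8)·e^{−6}`** = HALF of W72's attached-part bound `2·K₀(64,8)·e^{−6}` on the same datum
  (`mu_unit_bound_eq_half_attached`);
* §2 THE SECOND ROUTE ON THE SAME DATUM — N0o's μ-uniform (2.41) envelope `norm_locE_le_geom` ONCE BY NAME (`rodEnvelope_fires`, closed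
  `≤ K₀(64,8)·e^{−6}` for EVERY source `‖s‖ < 2`) and the triangle inequality: **`rodRateOneMu_triangle`: `‖E_{H_μ}(C_R) − E_{H_0}(C_R)‖ ≤
  2·K₀(64,8)·e^{−6}` on the OPEN source disc of radius 2, NO window margin**; the located comparison of the two routes
  **`schwarz_le_triangle_iff`: `K₀·e^{−6}·μ₀∕(2 − μ₀) ≤ 2·K₀·e^{−6} ↔ μ₀ ≤ 4∕3`** — the μ-face's Schwarz factor beats the envelope route
  exactly on the inner two thirds of the window and loses at its rim;
* §3 GENUINE on the datum: **`exp_locE_rod_mu`: `exp E_{H_μ}(C_R) = (1 + 2μc)∕(1 + μc)²` for every COMPLEX source `‖μ‖ ≤ 1`** (W72 PART 2's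
  `exp_locE_of_support_pair` BY NAME at `(D_A, D_B)`; PART 2's `exp_locE_rod` is the real source `1`), **`rodClusterMu_live`: `E_{H_μ}(C_R) ≠
  E_{H_0}(C_R)` for every `μ ≠ 0` with `‖μ‖ ≤ 1`** (`z² = 0 ⇒ z = 0` in ℂ at `z = μc`, `0 < c < ½`) and **`rodClusterMu_eq_iff`: on the closed unit
  source disc the μ-part of the cluster term vanishes iff `μ = 0`**; closing `example`: liveness ∧ §1's unit bound ∧ W72's attached-part
  bound `rodRateOne_fires_closed` BY NAME — both of N0o's pencil faces on the SAME datum, every `5 ≤ L`, `N′`, `0 < ‖μ‖ ≤ 1`.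

HONEST FRAMING.  A DECIDED TOY ([folklore]; 0 sorry; 0 citations; no `def`): the rod is W67's, the two-domino activity and every numeral
(`A₁ = A·e^{−5}∕2`, `r₁ = 1`, `b = 5`, `μ₁ = 2`, `4∕3`) are OURS (W72's) over pv22's located letters `κ₀ = 64 log 162`, `K₀(64,8)`, `ν = 9`,
`c₁ = 64`; `hL3` ((B3)'s (2.38)-majorant at the dressed constant) is MET BY CHOICE of the activity — NOT for Bałaban's densities (GAPS
G-ne9p2-5 UNPRINTED); the μ-extension of the small-field activities is the cell's UNPRINTED READING ([Balaban1989LargeFieldII] p. 356 defers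
observables; C-t4r2-340 (n1)) — TYPE∕CONTEXT only, nothing of it asserted; on a FIXED activity the rate bookkeeping redistributes decay
between the slope and the collected factor and the window bookkeeping trades the Schwarz factor against the margin — neither improves a
number on Bałaban's densities; no numeral of [Balaban1988RGII] ∕ [Balaban1987RGI] asserted ((2.11)–(2.13), (2.30), (2.38)–(2.41) =
TYPE∕CONTEXT); 0 binders instantiated on Bałaban's densities; no wall item; wall v1.8 (T4-DAG v48 deb37c21e2d251d1; v49∕v50 carry it
verbatim) — words, not kind — does NOT move; R-t4r2-Q2 NOT met thereby; NE1′ ⇐ the named binders — NOT proved, NOT printed; spine PROVED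
0∕9; count 9 unchanged.  Rung (B)+1 on ONE finite four-torus — NOT infinite volume, NOT a mass gap, NOT OS on ℝ⁴, NOT Clay.
HONEST DEPENDENCY: continuum YM on T⁴ ⇐ BetaPertH ∧ nine spine estimates (0/9 proved); BetaPertH ⇐ (D1) ∧ (D4) ∧ CAP+tail; G-an2-4
gates asym, D1 and NE2/3/4.
-/

noncomputable section

namespace Summit.QuantumFields.BalabanUV.T4Continuum.NE1p.DressedSmallFieldRodRateWitnessMu

open Set Metric Complex
open scoped BigOperators
open Literature.MathematicalPhysics.QuantumFieldTheory.Balaban1983to89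
open Literature.MathematicalPhysics.QuantumFieldTheory.Balaban1983to89.B12TreeDecay (K₀ K₀_pos)
open Literature.MathematicalPhysics.QuantumFieldTheory.Balaban1983to89.B13Resummation (locE)
open Literature.MathematicalPhysics.QuantumFieldTheory.Balaban1983to89.TreeLengthTorus (tsys tsys_dj)
open Literature.MathematicalPhysics.QuantumFieldTheory.Balaban1983to89.TreeLengthTorusGeometry (tgeometry)
open Summit.QuantumFields.BalabanUV.T4Continuum.NE1p.DressedSmallFieldGeometry (muPart_locE_le_geom norm_locE_le_geom torus_consts)
open Summit.QuantumFields.BalabanUV.T4Continuum.NE1p.DressedSmallFieldGeometryFaces (K₀_four)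
open Summit.QuantumFields.BalabanUV.T4Continuum.NE1p.DressedSmallFieldCoresWitness (Acst)
open Summit.QuantumFields.BalabanUV.T4Continuum.NE1p.DressedSmallFieldNestedToriRod (CR torusTreeLen_CR)
open Summit.QuantumFields.BalabanUV.T4Continuum.NE1p.DressedSmallFieldRodRateWitness (DA_ne_DB footprints actAB envAB actAB_DA
  actAB_DB actAB_of_ne hhol_AB hm_AB hL3_AB Rone Rone_eq Rone_pos Aone Aone_pos cAB cAB_pos two_cAB_eq hsmall_AB rodRateOne_fires_closed
  ttouch_DA_DB cAB_lt_half exp_locE_rod_zero exp_locE_of_support_pair)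

variable (L N' : ℕ) [NeZero L] [NeZero N']

/-! ## §1 THE μ-FACE FIRES AT RATE ONE ON THE ROD — N0o's `muPart_locE_le_geom` applied ONCE BY NAME, every socket a W72 lemma -/

open Classical in
/-- **THE OWNER's μ-FACE FIRES IN THE INTERIOR OF ITS RATE BOOKKEEPING** [decided toy]: `muPart_locE_le_geom` at `(tsys 4 (L·N′), tgeometry 4 (L·N′))`
with `A := 0 + 2·A₁`, `r₁ := 1`, `b := 5`, `R := R₁ = 1 + 2κ₀ + 2` (`hb`, `hrate` WITH EQUALITY, `hsmall` = W72's `hsmall_AB`), source radius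
`μ₁ := 2`, member `X₀ := C_R` (W67's rod), activity `actAB c`, envelope `envAB (2c)`; (E1)∕(E2)∕`hL3` = W72's `hhol_AB`∕`hm_AB`∕`hL3_AB`; the inner
window `0 < μ₀ < 2` and the source `‖μ‖ ≤ μ₀` displayed.  Conclusion LITERAL, with the decay factor `exp (−(1 · d(C_R)))` and the Schwarz factor
`μ₀∕(2 − μ₀)`. [folklore] -/
theorem rodRateOneMu_fires {μ₀ : ℝ} {μ : ℂ} (h0 : 0 < μ₀) (h01 : μ₀ < 2) (hμ : ‖μ‖ ≤ μ₀) :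
    ‖locE (tgeometry 4 (L * N')).ι (tgeometry 4 (L * N')).cubes (actAB L N' cAB μ) ((tgeometry 4 (L * N')).cubes (CR L N')) -
        locE (tgeometry 4 (L * N')).ι (tgeometry 4 (L * N')).cubes (actAB L N' cAB 0) ((tgeometry 4 (L * N')).cubes (CR L N'))‖ ≤
      Real.exp 1 * (tgeometry 4 (L * N')).ν * (tgeometry 4 (L * N')).c₁ * (tgeometry 4 (L * N')).K₀ ^ 2 * (0 + 2 * Aone) *
        Real.exp (-(1 * (tsys 4 (L * N')).dj (CR L N'))) * (μ₀ / (2 - μ₀)) :=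
  muPart_locE_le_geom (tsys 4 (L * N')) (tgeometry 4 (L * N')) (m := envAB L N' (2 * cAB)) (act := actAB L N' cAB)
    (A := 0 + 2 * Aone) (R := Rone) (r₁ := 1) (b := 5) (μ₁ := 2) (X₀ := CR L N')
    (by have := Aone_pos; positivity) zero_le_one (by norm_num) (Rone_eq (L * N')).le (hsmall_AB (L * N'))
    (hhol_AB L N' cAB 2 (CR L N')) (hm_AB L N' (ρ := 2) cAB_pos.le (CR L N'))
    (hL3_AB L N' (by have := Aone_pos; positivity) Rone_pos.le two_cAB_eq.le (CR L N')) h0 h01 hμ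

/-- The located envelope of the rate-one bookkeeping in closed form: `e·9·64·K₀(64,8)²·(0 + 2·(A·e^{−5}∕2))·e^{−(1·1)} = K₀(64,8)·e^{−6}`
(`d(C_R) = 1` by W67's `torusTreeLen_CR`, `5 ≤ L`; pv22's constants by `torus_consts`∕`K₀_four`; `A = (e·K₀(64,8)·9·64)⁻¹` W33's `Acst`). [arith] -/
theorem envelope_closed (hL : 5 ≤ L) :
    Real.exp 1 * (tgeometry 4 (L * N')).ν * (tgeometry 4 (L * N')).c₁ * (tgeometry 4 (L * N')).K₀ ^ 2 * (0 + 2 * Aone) *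
        Real.exp (-(1 * (tsys 4 (L * N')).dj (CR L N'))) = K₀ 64 8 * Real.exp (-6) := by
  rw [(torus_consts (L * N')).1, (torus_consts (L * N')).2.2, K₀_four, tsys_dj, torusTreeLen_CR L N' hL]
  unfold Aone Acst
  rw [show (-6 : ℝ) = -5 + -(1 * 1) by norm_num, Real.exp_add (-5)]
  have hK := K₀_pos (64 : ℝ) 8
  have he := Real.exp_pos 1
  field_simp
  ring

open Classical in
/-- **… IN CLOSED FORM**: `‖E_{H_μ}(C_R) − E_{H_0}(C_R)‖ ≤ K₀(64,8)·e^{−6}·μ₀∕(2 − μ₀)` for `0 < μ₀ < 2`, `‖μ‖ ≤ μ₀` (`5 ≤ L`) — the factor `e^{−6}` =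
the prepaid merging cost `e^{−b}` times the collected decay `e^{−r₁·d(C_R)}`, exactly as in W72's attached-part bound. [folklore] -/
theorem rodRateOneMu_fires_closed (hL : 5 ≤ L) {μ₀ : ℝ} {μ : ℂ} (h0 : 0 < μ₀) (h01 : μ₀ < 2) (hμ : ‖μ‖ ≤ μ₀) :
    ‖locE (tgeometry 4 (L * N')).ι (tgeometry 4 (L * N')).cubes (actAB L N' cAB μ) ((tgeometry 4 (L * N')).cubes (CR L N')) -
        locE (tgeometry 4 (L * N')).ι (tgeometry 4 (L * N')).cubes (actAB L N' cAB 0) ((tgeometry 4 (L * N')).cubes (CR L N'))‖ ≤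
      K₀ 64 8 * Real.exp (-6) * (μ₀ / (2 - μ₀)) := by
  rw [← envelope_closed L N' hL]; exact rodRateOneMu_fires L N' h0 h01 hμ

open Classical in
/-- **AT THE UNIT INNER WINDOW** (`μ₀ = 1`, Schwarz factor `1∕(2 − 1) = 1`): `‖E_{H_μ}(C_R) − E_{H_0}(C_R)‖ ≤ K₀(64,8)·e^{−6}` for every `‖μ‖ ≤ 1`. [folklore] -/
theorem rodRateOneMu_fires_unit (hL : 5 ≤ L) {μ : ℂ} (hμ : ‖μ‖ ≤ 1) :
    ‖locE (tgeometry 4 (L * N')).ι (tgeometry 4 (L * N')).cubes (actAB L N' cAB μ) ((tgeometry 4 (L * N')).cubes (CR L N')) -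
        locE (tgeometry 4 (L * N')).ι (tgeometry 4 (L * N')).cubes (actAB L N' cAB 0) ((tgeometry 4 (L * N')).cubes (CR L N'))‖ ≤
      K₀ 64 8 * Real.exp (-6) := by
  have h := rodRateOneMu_fires_closed L N' hL one_pos one_lt_two hμ
  norm_num at h
  exact h

/-- The μ-face's unit-window constant is HALF of W72's attached-part constant on the SAME datum and bookkeeping (`K₀·e^{−6}` vs `2·K₀·e^{−6}`):
the attached face pays the strength radius `ϱ = 2` through `4·A₁ = 2·A`, the μ-face at `μ₀ = 1` pays the Schwarz factor `1`. [arith] -/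
theorem mu_unit_bound_eq_half_attached : K₀ 64 8 * Real.exp (-6) = (2 * K₀ 64 8 * Real.exp (-6)) / 2 := by ring

/-! ## §2 THE SECOND ROUTE ON THE SAME DATUM: N0o's μ-uniform envelope `norm_locE_le_geom` ONCE BY NAME + the triangle inequality; the located
comparison with §1's Schwarz factor -/

open Classical in
/-- **THE μ-UNIFORM (2.41) ENVELOPE FIRES AT RATE ONE ON THE ROD** (N0o's `norm_locE_le_geom` EXACTLY ONCE BY NAME, the same sockets as §1):
`‖E_{H_s}(C_R)‖ ≤ e·ν·c₁·K₀²·(0 + 2·A₁)·e^{−(1·d(C_R))}` for EVERY source `‖s‖ < 2`. [folklore] -/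
theorem rodEnvelope_fires {s : ℂ} (hs : s ∈ ball (0 : ℂ) 2) :
    ‖locE (tgeometry 4 (L * N')).ι (tgeometry 4 (L * N')).cubes (actAB L N' cAB s) ((tgeometry 4 (L * N')).cubes (CR L N'))‖ ≤
      Real.exp 1 * (tgeometry 4 (L * N')).ν * (tgeometry 4 (L * N')).c₁ * (tgeometry 4 (L * N')).K₀ ^ 2 * (0 + 2 * Aone) *
        Real.exp (-(1 * (tsys 4 (L * N')).dj (CR L N'))) :=
  norm_locE_le_geom (tsys 4 (L * N')) (tgeometry 4 (L * N')) (m := envAB L N' (2 * cAB)) (act := actAB L N' cAB)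
    (A := 0 + 2 * Aone) (R := Rone) (r₁ := 1) (b := 5) (μ₁ := 2) (X₀ := CR L N')
    (by have := Aone_pos; positivity) zero_le_one (by norm_num) (Rone_eq (L * N')).le (hsmall_AB (L * N'))
    (hm_AB L N' (ρ := 2) cAB_pos.le (CR L N')) (hL3_AB L N' (by have := Aone_pos; positivity) Rone_pos.le two_cAB_eq.le (CR L N')) hs

open Classical in
/-- The envelope in closed form: `‖E_{H_s}(C_R)‖ ≤ K₀(64,8)·e^{−6}` for every `‖s‖ < 2` (`5 ≤ L`). [folklore] -/
theorem rodEnvelope_fires_closed (hL : 5 ≤ L) {s : ℂ} (hs : s ∈ ball (0 : ℂ) 2) :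
    ‖locE (tgeometry 4 (L * N')).ι (tgeometry 4 (L * N')).cubes (actAB L N' cAB s) ((tgeometry 4 (L * N')).cubes (CR L N'))‖ ≤
      K₀ 64 8 * Real.exp (-6) := by
  rw [← envelope_closed L N' hL]; exact rodEnvelope_fires L N' hs

open Classical in
/-- **THE TRIANGLE ROUTE TO THE μ-PART**: `‖E_{H_μ}(C_R) − E_{H_0}(C_R)‖ ≤ 2·K₀(64,8)·e^{−6}` for EVERY source in the OPEN disc `‖μ‖ < 2` — no inner
window, no Schwarz factor: §2's envelope at `μ` and at `0`. [folklore] -/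
theorem rodRateOneMu_triangle (hL : 5 ≤ L) {μ : ℂ} (hμ : ‖μ‖ < 2) :
    ‖locE (tgeometry 4 (L * N')).ι (tgeometry 4 (L * N')).cubes (actAB L N' cAB μ) ((tgeometry 4 (L * N')).cubes (CR L N')) -
        locE (tgeometry 4 (L * N')).ι (tgeometry 4 (L * N')).cubes (actAB L N' cAB 0) ((tgeometry 4 (L * N')).cubes (CR L N'))‖ ≤
      2 * (K₀ 64 8 * Real.exp (-6)) := by
  have h1 := rodEnvelope_fires_closed L N' hL (s := μ) (mem_ball_zero_iff.2 hμ)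
  have h0 := rodEnvelope_fires_closed L N' hL (s := 0) (mem_ball_self two_pos)
  calc _ ≤ ‖locE (tgeometry 4 (L * N')).ι (tgeometry 4 (L * N')).cubes (actAB L N' cAB μ) ((tgeometry 4 (L * N')).cubes (CR L N'))‖ +
        ‖locE (tgeometry 4 (L * N')).ι (tgeometry 4 (L * N')).cubes (actAB L N' cAB 0) ((tgeometry 4 (L * N')).cubes (CR L N'))‖ :=
      norm_sub_le _ _
    _ ≤ _ := by linarith

/-- **THE LOCATED COMPARISON OF THE TWO ROUTES**: for an inner window `0 < μ₀ < 2`, §1's Schwarz bound `K₀·e^{−6}·μ₀∕(2 − μ₀)` is at most §2's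
triangle bound `2·K₀·e^{−6}` EXACTLY when `μ₀ ≤ 4∕3` — the μ-face wins on the inner two thirds of the source window and loses at its rim. [arith] -/
theorem schwarz_le_triangle_iff {μ₀ : ℝ} (h01 : μ₀ < 2) :
    K₀ 64 8 * Real.exp (-6) * (μ₀ / (2 - μ₀)) ≤ 2 * (K₀ 64 8 * Real.exp (-6)) ↔ μ₀ ≤ 4 / 3 := by
  have hK : 0 < K₀ (64 : ℝ) 8 * Real.exp (-6) := mul_pos (K₀_pos _ _) (Real.exp_pos _)
  have h2 : 0 < 2 - μ₀ := by linarith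
  rw [mul_comm (2 : ℝ), mul_le_mul_iff_right₀ hK, div_le_iff₀ h2]
  constructor <;> intro h <;> linarith

/-- At the unit window the Schwarz route is STRICTLY better than the triangle route (`K₀·e^{−6} < 2·K₀·e^{−6}`). [arith] -/
theorem unit_lt_triangle : K₀ 64 8 * Real.exp (-6) < 2 * (K₀ 64 8 * Real.exp (-6)) := by
  have hK : 0 < K₀ (64 : ℝ) 8 * Real.exp (-6) := mul_pos (K₀_pos _ _) (Real.exp_pos _)
  linarith

/-! ## §3 GENUINE ON THE DATUM: the μ-part of `E(C_R)` in closed form on the closed unit source disc — live, and zero ONLY at the centre -/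

open Classical in
/-- **THE μ-PART AT THE ROD IS THE TWO-DOMINO URSELL TERM AT A COMPLEX SOURCE**: for every `‖μ‖ ≤ 1`,
`exp E_{H_μ}(C_R) = (1 + μc + μc)∕((1 + μc)(1 + μc))` — W72 PART 2's pair formula `exp_locE_of_support_pair` at `(P, Q) = (D_A, D_B)` with the
activity `actAB c μ` (`‖μc‖ < ½` by `cAB_lt_half`); PART 2's `exp_locE_rod` is the real source `μ = 1`. [folklore] -/
theorem exp_locE_rod_mu (hL : 5 ≤ L) {μ : ℂ} (hμ : ‖μ‖ ≤ 1) :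
    cexp (locE (tgeometry 4 (L * N')).ι (tgeometry 4 (L * N')).cubes (actAB L N' cAB μ) ((tgeometry 4 (L * N')).cubes (CR L N'))) =
      (1 + μ * cAB + μ * cAB) / ((1 + μ * cAB) * (1 + μ * cAB)) := by
  have hn : ‖μ * (cAB : ℂ)‖ < 1 / 2 := by
    rw [norm_mul, Complex.norm_real, Real.norm_eq_abs, abs_of_nonneg cAB_pos.le]
    calc ‖μ‖ * cAB ≤ 1 * cAB := mul_le_mul_of_nonneg_right hμ cAB_pos.le
      _ < 1 / 2 := by rw [one_mul]; exact cAB_lt_half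
  have h := exp_locE_of_support_pair (tgeometry 4 (L * N')).ι (tgeometry 4 (L * N')).ι_symm (tgeometry 4 (L * N')).cubes
    (actAB L N' cAB μ) (DA_ne_DB L N' hL) (ttouch_DA_DB L N') (footprints L N' hL).1 (footprints L N' hL).2.1 (footprints L N' hL).2.2
    (fun Z _ hA hB => actAB_of_ne L N' cAB μ hA hB) (by rw [actAB_DA]; exact hn) (by rw [actAB_DB]; exact hn)
  rw [actAB_DA, actAB_DB] at h
  exact h

open Classical in
/-- **THE μ-PART OF THE CLUSTER TERM IS LIVE ON THE WHOLE PUNCTURED UNIT DISC**: `E_{H_μ}(C_R) ≠ E_{H_0}(C_R)` for every source `μ ≠ 0` with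
`‖μ‖ ≤ 1` — exponentials `(1 + 2z)∕(1 + z)² = 1` with `z = μc` force `z² = 0`, i.e. `z = 0`, and `c ≠ 0` (`cAB_pos`). [folklore] -/
theorem rodClusterMu_live (hL : 5 ≤ L) {μ : ℂ} (hμ0 : μ ≠ 0) (hμ : ‖μ‖ ≤ 1) :
    locE (tgeometry 4 (L * N')).ι (tgeometry 4 (L * N')).cubes (actAB L N' cAB μ) ((tgeometry 4 (L * N')).cubes (CR L N')) ≠
      locE (tgeometry 4 (L * N')).ι (tgeometry 4 (L * N')).cubes (actAB L N' cAB 0) ((tgeometry 4 (L * N')).cubes (CR L N')) := by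
  intro h
  have h1 := exp_locE_rod_mu L N' hL hμ
  rw [h, exp_locE_rod_zero L N' hL] at h1
  have hz : ‖μ * (cAB : ℂ)‖ < 1 := by
    rw [norm_mul, Complex.norm_real, Real.norm_eq_abs, abs_of_nonneg cAB_pos.le]
    calc ‖μ‖ * cAB ≤ 1 * cAB := mul_le_mul_of_nonneg_right hμ cAB_pos.le
      _ < 1 := by rw [one_mul]; linarith [cAB_lt_half]
  have hne1 : (1 : ℂ) + μ * cAB ≠ 0 := by
    intro h0
    have : μ * (cAB : ℂ) = -1 := by linear_combination h0
    rw [this, norm_neg, norm_one] at hz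
    exact lt_irrefl _ hz
  rw [eq_div_iff (mul_ne_zero hne1 hne1), one_mul] at h1
  have hzz : μ * (cAB : ℂ) * (μ * cAB) = 0 := by linear_combination h1
  rcases mul_eq_zero.1 (mul_self_eq_zero.1 hzz) with h2 | h2
  · exact hμ0 h2
  · exact cAB_pos.ne' (by exact_mod_cast h2)

open Classical in
/-- **… AND VANISHES ONLY AT THE CENTRE OF THE SOURCE DISC**: on `‖μ‖ ≤ 1`, `E_{H_μ}(C_R) = E_{H_0}(C_R) ↔ μ = 0`. [folklore] -/
theorem rodClusterMu_eq_iff (hL : 5 ≤ L) {μ : ℂ} (hμ : ‖μ‖ ≤ 1) :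
    locE (tgeometry 4 (L * N')).ι (tgeometry 4 (L * N')).cubes (actAB L N' cAB μ) ((tgeometry 4 (L * N')).cubes (CR L N')) =
        locE (tgeometry 4 (L * N')).ι (tgeometry 4 (L * N')).cubes (actAB L N' cAB 0) ((tgeometry 4 (L * N')).cubes (CR L N')) ↔
      μ = 0 :=
  ⟨fun h => by_contra fun hμ0 => rodClusterMu_live L N' hL hμ0 hμ h, fun h => by rw [h]⟩

open Classical in
/-- **BOTH OF N0o's PENCIL FACES HAVE FIRED AT RATE ONE ON THE SAME LIVE DATUM**: for every `5 ≤ L`, `N′` and every source `0 < ‖μ‖ ≤ 1` the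
μ-part of the cluster term is NOT zero and is `≤ K₀(64,8)·e^{−6}` by the μ-face (§1), while the attached part is `≤ 2·K₀(64,8)·e^{−6}` by the
table-strength face (W72's `rodRateOne_fires_closed` BY NAME). [folklore] -/
example (hL : 5 ≤ L) {μ : ℂ} (hμ0 : μ ≠ 0) (hμ : ‖μ‖ ≤ 1) :
    locE (tgeometry 4 (L * N')).ι (tgeometry 4 (L * N')).cubes (actAB L N' cAB μ) ((tgeometry 4 (L * N')).cubes (CR L N')) ≠
        locE (tgeometry 4 (L * N')).ι (tgeometry 4 (L * N')).cubes (actAB L N' cAB 0) ((tgeometry 4 (L * N')).cubes (CR L N')) ∧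
      ‖locE (tgeometry 4 (L * N')).ι (tgeometry 4 (L * N')).cubes (actAB L N' cAB μ) ((tgeometry 4 (L * N')).cubes (CR L N')) -
          locE (tgeometry 4 (L * N')).ι (tgeometry 4 (L * N')).cubes (actAB L N' cAB 0) ((tgeometry 4 (L * N')).cubes (CR L N'))‖ ≤
        K₀ 64 8 * Real.exp (-6) ∧
      ‖locE (tgeometry 4 (L * N')).ι (tgeometry 4 (L * N')).cubes (actAB L N' cAB 1) ((tgeometry 4 (L * N')).cubes (CR L N')) -
          locE (tgeometry 4 (L * N')).ι (tgeometry 4 (L * N')).cubes (actAB L N' cAB 0) ((tgeometry 4 (L * N')).cubes (CR L N'))‖ ≤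
        2 * K₀ 64 8 * Real.exp (-6) :=
  ⟨rodClusterMu_live L N' hL hμ0 hμ, rodRateOneMu_fires_unit L N' hL hμ, rodRateOne_fires_closed L N' hL⟩

end Summit.QuantumFields.BalabanUV.T4Continuum.NE1p.DressedSmallFieldRodRateWitnessMu

end
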